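import Summits.HodgeConjecture.CorCM.QuarticCMTypeSlice
import Summits.HodgeConjecture.CorCM.CyclotomicSliceOfAoki
import Summits.HodgeConjecture.CorCM.Model.CMDominationOfRiemannRealised
import Summits.HodgeConjecture.CorCM.Model.DimZeroDomination
import Summits.HodgeConjecture.CorCM.Interfaces
import Literature.NumberTheory.NumberFields.CMFieldCompositum
import HarnessLib

/-!
# `HC_CM` is exhausted by its Galois-CM-field slices — and each slice is decided by ONE abelian variety

COR-CM (cell `pub-hodgecm2` = stage 2 of the Hodge ladder), seat b24, count-neutral lane SLICE-EXHAUSTION (no row of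
`HOME/BINDER-OWNERS.md`; theorems only, no definition, no named fact).  `HC_CM` is BY NAME the route item
`Theses.RankFourFaces.CMAbelianHodge` (`∀ A : AbelianVariety ℂ, IsSmoothProjective A.dim A.X → IsOfCMType A →
HodgeConjectureFor A.dim A.X`, `CorCM/Interfaces.lean`).  The per-field slice files of the cell (degree `≤ 4`:
`CMSliceDegreeLeFour`; cyclotomic: `CyclotomicSlice*`; Galois sextic modulo Markman: `CyclicSexticCMTypeSliceOfMarkman`)
all conclude `HodgeConjectureFor` for the left-nested products `Domination.cmProdAV F h₃ n Θ = ∏_{j ≤ n} A_{(F,Θ_j)}` of the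
CHOSEN realisations of CM types `Θ_j` of ONE CM field `F`.  This file records that these slices are, literally, a cover of
`HC_CM`, monotone and cofinal in `F`, and that each slice is decided by the powers of a single abelian variety:

* §1 `isOfCMType_cmProdAV`, `dim_cmProdAV_pos` — `∏_j A_{(F,Θ_j)}` is of CM type (Milne's étale form) and positive
  dimensional; hence (§2) `hodgeConjectureFor_cmProdAV_of_hc_cm` — `HC_CM` gives every slice.
* §3 `hc_cm_of_forall_galois_cmProdAV`, **`hc_cm_iff_forall_galois_cmProdAV`** — `HC_CM ⟺` for every CM field `F`
  GALOIS over `ℚ` with `6 ≤ [F:ℚ]` and every finite family `Θ` of CM types of `F`, `HodgeConjectureFor (∏_j A_{(F,Θ_j)})`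
  (`⟸`: every complex abelian variety of CM type is dominated by such a product over such a field —
  `Domination.cmDominated_of_isOfCMType_of_riemann` at the tree theorems `deligneMilne1982_Thm_6_20_full_holds`,
  `cmAbelianVarietyRealised_holds` — and `HodgeConjectureFor` descends along dominations,
  `Domination.hodgeConjectureFor_of_avDominatedBy`); `hc_cm_iff_forall_cmProdAV` (all CM fields, no side condition).
* §4 MONOTONE: `avDominatedBy_cmProdAV_inflate` — along `e : F →+* F'`, `∏_j A_{(F,Θ_j)} ≼ ∏_j A_{(F',Θ_j^{F'})}` (Shimura's
  inflation §6.2 Thm. 3 at the tree theorem `shimura1998_Thm3_isogenousPower_and_Thm2_cor`, factor by factor through the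
  biproduct `nonempty_cmProdAV_iso_biproduct`); `forall_cmProdAV_of_ringHom` — the slice at `F'` implies the slice at `F`.
* §5 COFINAL: `exists_isGalois_ringHom_ringHom` — two CM number fields embed into one Galois CM field (the compositum of
  their normal closures in `ℂ`, Shimura §18.2 Lemma (ii)–(iii) = tree `NumberFields.CMFieldCompositum`);
  **`hc_cm_iff_forall_galois_cmProdAV_over F₀`** — for ANY CM field `F₀`, `HC_CM ⟺` the slices at the Galois CM fields
  receiving `F₀`.
* §6 ONE ABELIAN VARIETY PER FIELD: `avDominatedBy_cmProdAV_powSucc_of_meets` — if a finite family `Θ₀` meets every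
  `(Aut F × {1, bar})`-orbit of CM types of `F`, every `∏_j A_{(F,Θ_j)}` is an isogeny factor of a power of
  `P_F := ∏_i A_{(F,Θ₀ i)}`; **`forall_cmProdAV_iff_forall_powSucc`** — the slice at `F` `⟺ ∀ k, HodgeConjectureFor (P_F^{k+1})`;
  `exists_surjective_cmType` — such finite families exist; **`hc_cm_iff_forall_galois_powSucc`** — `HC_CM ⟺` for every
  Galois CM field `F` of degree `≥ 6` and (any/every) enumeration `Θ₀` of its CM types, HC for all powers of `∏_i A_{(F,Θ₀ i)}`.

Nothing here asserts `HC_CM` or any slice; every statement is an equivalence or an implication between them.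

## References
* [Shimura1998] G. Shimura, *Abelian Varieties with Complex Multiplication and Modular Functions* (1998), §6.1
  Corollary of Theorem 2 (p. 41), §6.2 Theorem 3 (pp. 41–43), §18.2 Lemma (ii)–(iii).
* [MumfordAV1970] D. Mumford, *Abelian Varieties* (1970), §19 Thm. 1 and Remark p. 169 (isogeny factors).
* [Milne2020HodgeClassesAV] J. S. Milne, *Hodge classes on abelian varieties* (2020), proof of Thm. 1 («we may suppose that
  `A` is a product `∏ A_Φ`» over one Galois CM field).
* [Andre1992HodgeCM] Y. André, Progr. Math. 102 (1992), p. 4 («quitte à remplacer `A` par une variété isogène … produit»).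
* [Deligne1982HodgeCycles] P. Deligne, LNM 900 (1982), §5 (b) (twisting the CM structure by automorphisms / conjugation).
-/

noncomputable section

open CategoryTheory CategoryTheory.Limits NumberField
open Literature.AlgebraicGeometry Literature.AlgebraicGeometry.Motives Literature.AlgebraicGeometry.HodgeTheory
open Literature.AlgebraicGeometry.ComplexMultiplication Literature.AlgebraicGeometry.Milne1999
open Literature.NumberTheory.ComplexMultiplication (inducedCMType isOfCMType_of_isCMTypeRealisation)
open Literature.NumberTheory.ComplexMultiplication.CMTypeOps (bar mem_bar_iff)
open Literature.NumberTheory.Automorphic.PicardCM (cmRealisation CMAbelianVarietyRealised)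
open Literature.NumberTheory.Automorphic.PicardCM.CMCode (cmTypeMap mem_cmTypeMap_iff)
open Literature.NumberTheory.NumberFields (isGalois_normalClosure_complex isCMField_normalClosure
  isTotallyReal_or_isCMField_normalClosure)
open IntermediateField (normalClosure)
open Summit.HodgeConjecture.CorCM.Domination

namespace Summit.HodgeConjecture.CorCM.SliceExhaustion

variable {F : Type} [Field F] [NumberField F] [IsCMField F]

/-! ## §1 `∏_j A_{(F,Θ_j)}` is a complex abelian variety of CM type of positive dimension -/

/-- The chosen realisation `A_{(F,Φ)}` has dimension `[F:ℚ]/2 > 0` (it is smooth projective of dimension `[F:ℚ]/2`,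
`isCMTypeRealisation_cmCode`, and a CM field has degree `≥ 2`). [cite: Shimura1998, §6.2 Theorem 3 (pp. 41–42)] -/
theorem dim_cmAV_pos (h₃ : CMAbelianVarietyRealised) (Φ : CMType F) :
    0 < (cmRealisation h₃ (cmCode F Φ)).AV.dim := by
  have h := isCMTypeRealisation_cmCode F h₃ Φ
  have hdim : (cmRealisation h₃ (cmCode F Φ)).AV.dim = Module.finrank ℚ F / 2 := Motives.schemeDim_eq_holds h.1
  have h2 : Module.finrank ℚ F = 2 * InfinitePlace.nrComplexPlaces F := by
    rw [← InfinitePlace.card_add_two_mul_card_eq_rank, IsTotallyComplex.nrRealPlaces_eq_zero, zero_add]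
  have hpos : 0 < Module.finrank ℚ F := Module.finrank_pos
  omega

/-- The chosen realisation `A_{(F,Φ)}` is of CM type (Milne's étale form: `End⁰ ⊇ ℚ·ι(𝓞_F) ≅ F`, commutative reduced
of dimension `[F:ℚ] = 2 dim`). [cite: Milne1999, §2 p. 54] [cite: Shimura1998, §5.2 (pp. 36–37)] -/
theorem isOfCMType_cmAV (h₃ : CMAbelianVarietyRealised) (Φ : CMType F) :
    IsOfCMType (cmRealisation h₃ (cmCode F Φ)).AV :=
  isOfCMType_of_isCMTypeRealisation (isCMTypeRealisation_cmCode F h₃ Φ)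

/-- `∏_{j ≤ n} A_{(F,Θ_j)}` has positive dimension (`dim (A × B) = dim A + dim B`). [cite: MumfordAV1970, §19] -/
theorem dim_cmProdAV_pos (h₃ : CMAbelianVarietyRealised) :
    ∀ (n : ℕ) (Θ : Fin (n + 1) → CMType F), 0 < (cmProdAV F h₃ n Θ).dim
  | 0, Θ => by
      rw [cmProdAV_zero]
      exact dim_cmAV_pos h₃ (Θ 0)
  | n + 1, Θ => by
      rw [cmProdAV_succ, AbelianVariety.dim_prod]
      exact Nat.add_pos_left (dim_cmProdAV_pos h₃ n _) _

/-- **`∏_{j ≤ n} A_{(F,Θ_j)}` is of CM type** (products of CM-type abelian varieties of positive dimension are of CM type,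
`Milne1999.CMTypeProducts.isOfCMType_prod`; induction along `cmProdAV_succ`).
[cite: Milne1999, §2 p. 54] [cite: Deligne1982HodgeCycles, §5 (pp. 62–63) and Prop. 5.1] -/
theorem isOfCMType_cmProdAV (h₃ : CMAbelianVarietyRealised) :
    ∀ (n : ℕ) (Θ : Fin (n + 1) → CMType F), IsOfCMType (cmProdAV F h₃ n Θ)
  | 0, Θ => by
      rw [cmProdAV_zero]
      exact isOfCMType_cmAV h₃ (Θ 0)
  | n + 1, Θ => by
      rw [cmProdAV_succ]
      exact CMTypeProducts.isOfCMType_prod (isOfCMType_cmProdAV h₃ n _) (isOfCMType_cmAV h₃ _)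
        (dim_cmProdAV_pos h₃ n _) (dim_cmAV_pos h₃ _)

/-! ## §2 `HC_CM` gives every slice -/

/-- **`HC_CM ⟹ HodgeConjectureFor (∏_j A_{(F,Θ_j)})`** for every CM field `F` and every finite family of CM types:
the product meets both binders of `CMAbelianHodge` (`AbelianVariety.isSmoothProjective_holds`, `isOfCMType_cmProdAV`).
[cite: Milne1999, §2 p. 54] -/
theorem hodgeConjectureFor_cmProdAV_of_hc_cm (h : HC_CM) (h₃ : CMAbelianVarietyRealised) (n : ℕ)
    (Θ : Fin (n + 1) → CMType F) : HodgeConjectureFor (cmProdAV F h₃ n Θ).dim (cmProdAV F h₃ n Θ).X :=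
  h _ AbelianVariety.isSmoothProjective_holds (isOfCMType_cmProdAV h₃ n Θ)

/-! ## §3 The Galois slices of degree `≥ 6` give `HC_CM` -/

/-- **`HC_CM` from its Galois-CM-field slices.**  If for every CM field `F`, Galois over `ℚ` with `6 ≤ [F:ℚ]`, and every
finite family `Θ` of CM types of `F` the product `∏_j A_{(F,Θ_j)}` satisfies the Hodge conjecture, then `HC_CM` holds:
every complex abelian variety `A` of CM type is dominated (`s ≫ π = [N]_A`, `N ≠ 0`) by such a product over such a field
(`Domination.cmDominated_of_isOfCMType_of_riemann`, at the tree theorems `deligneMilne1982_Thm_6_20_full_holds` and `h₃`),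
and `HodgeConjectureFor` descends along dominations (`Domination.hodgeConjectureFor_of_avDominatedBy`).
[cite: Milne2020HodgeClassesAV, proof of Theorem 1] [cite: Andre1992HodgeCM, p. 4] [cite: MumfordAV1970, §19 Thm. 1 and p. 169] -/
theorem hc_cm_of_forall_galois_cmProdAV (h₃ : CMAbelianVarietyRealised)
    (h : ∀ (F : Type) [Field F] [NumberField F] [IsCMField F], IsGalois ℚ F → 6 ≤ Module.finrank ℚ F →
      ∀ (n : ℕ) (Θ : Fin (n + 1) → CMType F), HodgeConjectureFor (cmProdAV F h₃ n Θ).dim (cmProdAV F h₃ n Θ).X) :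
    HC_CM := by
  intro A _ hCM
  obtain ⟨F, _, _, _, hG, h6, n, Θ, hA⟩ :=
    cmDominated_of_isOfCMType_of_riemann deligneMilne1982_Thm_6_20_full_holds h₃ A hCM
  exact hodgeConjectureFor_of_avDominatedBy (h F hG h6 n Θ) hA

/-- **`HC_CM` ⟺ its Galois-CM-field slices of degree `≥ 6`**: the Hodge conjecture for complex abelian varieties of CM
type is EQUIVALENT to the Hodge conjecture for the products `∏_j A_{(F,Θ_j)}` of chosen realisations of CM types of one CM
field `F`, `F` ranging over the CM fields Galois over `ℚ` of degree `≥ 6`.  Neither side is asserted.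
[cite: Milne2020HodgeClassesAV, proof of Theorem 1] [cite: Andre1992HodgeCM, p. 4] -/
theorem hc_cm_iff_forall_galois_cmProdAV (h₃ : CMAbelianVarietyRealised) :
    HC_CM ↔ ∀ (F : Type) [Field F] [NumberField F] [IsCMField F], IsGalois ℚ F → 6 ≤ Module.finrank ℚ F →
      ∀ (n : ℕ) (Θ : Fin (n + 1) → CMType F), HodgeConjectureFor (cmProdAV F h₃ n Θ).dim (cmProdAV F h₃ n Θ).X :=
  ⟨fun h _ _ _ _ _ _ n Θ => hodgeConjectureFor_cmProdAV_of_hc_cm h h₃ n Θ, hc_cm_of_forall_galois_cmProdAV h₃⟩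

/-- **`HC_CM` ⟺ all its one-field slices** (every CM field, no side condition). [cite: Milne2020HodgeClassesAV, proof of Theorem 1] -/
theorem hc_cm_iff_forall_cmProdAV (h₃ : CMAbelianVarietyRealised) :
    HC_CM ↔ ∀ (F : Type) [Field F] [NumberField F] [IsCMField F] (n : ℕ) (Θ : Fin (n + 1) → CMType F),
      HodgeConjectureFor (cmProdAV F h₃ n Θ).dim (cmProdAV F h₃ n Θ).X :=
  ⟨fun h _ _ _ _ n Θ => hodgeConjectureFor_cmProdAV_of_hc_cm h h₃ n Θ,
    fun h => hc_cm_of_forall_galois_cmProdAV h₃ fun F _ _ _ _ _ n Θ => h F n Θ⟩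

/-! ## §4 Monotonicity in the field: inflation along `F →+* F'` -/

section Monotone

variable {F' : Type} [Field F'] [NumberField F'] [IsCMField F']

/-- **`A_{(F,Φ)} ≼ A_{(F',Φ^{F'})}`** along `e : F →+* F'`: the chosen realisation of `Φ` realises `Φ` on `H¹`
(`isCMTypeRealisation_cmCode`), so Shimura's inflation dominates it by the chosen realisation of the induced type
`inducedCMType e Φ` (`Domination.avDominatedBy_cmAV_of_isCMTypeRealisation_of_embedding` at the tree theorem
`shimura1998_Thm3_isogenousPower_and_Thm2_cor`). [cite: Shimura1998, §6.2 Theorem 3 and §6.1 Corollary of Theorem 2 (pp. 41–43)] -/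
theorem avDominatedBy_cmAV_inflate (h₃ : CMAbelianVarietyRealised) (e : F →+* F') (Φ : CMType F) :
    AVDominatedBy (cmRealisation h₃ (cmCode F Φ)).AV (cmRealisation h₃ (cmCode F' (inducedCMType e Φ))).AV :=
  avDominatedBy_cmAV_of_isCMTypeRealisation_of_embedding h₃ shimura1998_Thm3_isogenousPower_and_Thm2_cor.1
    shimura1998_Thm3_isogenousPower_and_Thm2_cor.2 e (isCMTypeRealisation_cmCode F h₃ Φ)

/-- **`∏_j A_{(F,Θ_j)} ≼ ∏_j A_{(F',Θ_j^{F'})}`** along `e : F →+* F'` — factor by factor through the biproducts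
(`AVDominatedBy.biproduct_of_cmProdAV`, `biproduct_map`, `cmProdAV_of_biproduct`).
[cite: Shimura1998, §6.2 Theorem 3 (pp. 41–43)] [cite: MumfordAV1970, §19] -/
theorem avDominatedBy_cmProdAV_inflate (h₃ : CMAbelianVarietyRealised) (e : F →+* F') (n : ℕ)
    (Θ : Fin (n + 1) → CMType F) :
    AVDominatedBy (cmProdAV F h₃ n Θ) (cmProdAV F' h₃ n fun j => inducedCMType e (Θ j)) :=
  (((AVDominatedBy.refl _).biproduct_of_cmProdAV (F := F)).trans
    (AVDominatedBy.biproduct_map fun j => avDominatedBy_cmAV_inflate h₃ e (Θ j))).cmProdAV_of_biproduct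

/-- **The slice at `F'` implies the slice at every `F` embedding into `F'`.** [cite: Shimura1998, §6.2 Theorem 3 (pp. 41–43)] -/
theorem forall_cmProdAV_of_ringHom (h₃ : CMAbelianVarietyRealised) (e : F →+* F')
    (h : ∀ (n : ℕ) (Θ' : Fin (n + 1) → CMType F'),
      HodgeConjectureFor (cmProdAV F' h₃ n Θ').dim (cmProdAV F' h₃ n Θ').X)
    (n : ℕ) (Θ : Fin (n + 1) → CMType F) : HodgeConjectureFor (cmProdAV F h₃ n Θ).dim (cmProdAV F h₃ n Θ).X :=
  hodgeConjectureFor_of_avDominatedBy (h n _) (avDominatedBy_cmProdAV_inflate h₃ e n Θ)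

end Monotone

/-! ## §5 Cofinality: only the Galois CM fields over a fixed `F₀` matter -/

/-- **Two CM number fields embed into one CM field Galois over `ℚ`**: the compositum `L` inside `ℂ` of their normal
closures `normalClosure ℚ F ℂ ⊔ normalClosure ℚ F₀ ℂ` is a number field, Galois over `ℚ` (compositum of normal
extensions) and CM (Shimura §18.2 Lemma (ii)–(iii): tree `isCMField_normalClosure`, `IntermediateField.isCMField_sup_of_isCMField_left`).
[cite: Shimura1998, §18.2 Lemma (ii)–(iii)] -/
theorem exists_isGalois_ringHom_ringHom (F F₀ : Type) [Field F] [NumberField F] [IsCMField F] [Field F₀]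
    [NumberField F₀] [IsCMField F₀] :
    ∃ (L : Type) (_ : Field L) (_ : NumberField L) (_ : IsCMField L),
      IsGalois ℚ L ∧ Nonempty (F →+* L) ∧ Nonempty (F₀ →+* L) := by
  let L : IntermediateField ℚ ℂ := normalClosure ℚ F ℂ ⊔ normalClosure ℚ F₀ ℂ
  haveI : FiniteDimensional ℚ (normalClosure ℚ F ℂ) := normalClosure.is_finiteDimensional ℚ F ℂ
  haveI : FiniteDimensional ℚ (normalClosure ℚ F₀ ℂ) := normalClosure.is_finiteDimensional ℚ F₀ ℂ
  have hn : Normal ℚ (normalClosure ℚ F ℂ) := (isGalois_normalClosure_complex F).to_normal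
  have hn₀ : Normal ℚ (normalClosure ℚ F₀ ℂ) := (isGalois_normalClosure_complex F₀).to_normal
  haveI hfd : FiniteDimensional ℚ L := IntermediateField.finiteDimensional_sup _ _
  haveI : NumberField L := { to_charZero := inferInstance, to_finiteDimensional := hfd }
  haveI : IsCMField L :=
    Literature.NumberTheory.NumberFields.IntermediateField.isCMField_sup_of_isCMField_left _ _
      (isCMField_normalClosure F) (isTotallyReal_or_isCMField_normalClosure F₀ (Or.inr inferInstance))
  haveI : Normal ℚ L :=
    @IntermediateField.normal_sup ℚ ℂ _ _ _ (normalClosure ℚ F ℂ) (normalClosure ℚ F₀ ℂ) hn hn₀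
  have eF : F →+* L := by
    let φ : F →ₐ[ℚ] ℂ := (Classical.arbitrary (F →+* ℂ)).toRatAlgHom
    exact ((IntermediateField.inclusion (le_sup_left : normalClosure ℚ F ℂ ≤ L)).comp
      (φ.codRestrict (normalClosure ℚ F ℂ).toSubalgebra fun x => φ.fieldRange_le_normalClosure ⟨x, rfl⟩)).toRingHom
  have eF₀ : F₀ →+* L := by
    let φ : F₀ →ₐ[ℚ] ℂ := (Classical.arbitrary (F₀ →+* ℂ)).toRatAlgHom
    exact ((IntermediateField.inclusion (le_sup_right : normalClosure ℚ F₀ ℂ ≤ L)).comp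
      (φ.codRestrict (normalClosure ℚ F₀ ℂ).toSubalgebra fun x => φ.fieldRange_le_normalClosure ⟨x, rfl⟩)).toRingHom
  exact ⟨L, inferInstance, inferInstance, inferInstance, ⟨⟩, ⟨eF⟩, ⟨eF₀⟩⟩

/-- **`HC_CM` ⟺ its slices at the Galois CM fields receiving a fixed CM field `F₀`** (cofinality: by §4 the family of
slices is monotone in `F`, and every CM field embeds, together with `F₀`, into a Galois CM field).
[cite: Shimura1998, §6.2 Theorem 3 and §18.2 Lemma (ii)–(iii)] [cite: Milne2020HodgeClassesAV, proof of Theorem 1] -/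
theorem hc_cm_iff_forall_galois_cmProdAV_over (F₀ : Type) [Field F₀] [NumberField F₀] [IsCMField F₀]
    (h₃ : CMAbelianVarietyRealised) :
    HC_CM ↔ ∀ (F : Type) [Field F] [NumberField F] [IsCMField F], IsGalois ℚ F → Nonempty (F₀ →+* F) →
      ∀ (n : ℕ) (Θ : Fin (n + 1) → CMType F), HodgeConjectureFor (cmProdAV F h₃ n Θ).dim (cmProdAV F h₃ n Θ).X := by
  refine ⟨fun h _ _ _ _ _ _ n Θ => hodgeConjectureFor_cmProdAV_of_hc_cm h h₃ n Θ, fun h => ?_⟩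
  refine (hc_cm_iff_forall_cmProdAV h₃).2 fun F _ _ _ n Θ => ?_
  obtain ⟨L, _, _, _, hL, ⟨e⟩, he₀⟩ := exists_isGalois_ringHom_ringHom F F₀
  exact forall_cmProdAV_of_ringHom h₃ e (h L hL he₀) n Θ

/-! ## §6 One abelian variety per field -/

omit [NumberField F] [IsCMField F] in
/-- `bar` is an involution on CM types. [folklore] -/
theorem bar_bar (Φ : CMType F) : bar (bar Φ) = Φ :=
  Subtype.ext (compl_compl Φ.1)

/-- **A factor is dominated by the product**: `A_{(F,Θ₀ i)} ≼ ∏_j A_{(F,Θ₀ j)}` (`biproduct.ι ≫ biproduct.π = 𝟙`, read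
on the left-nested product through `nonempty_cmProdAV_iso_biproduct`). [cite: MumfordAV1970, §19] -/
theorem avDominatedBy_cmAV_cmProdAV (h₃ : CMAbelianVarietyRealised) {N : ℕ} (Θ₀ : Fin (N + 1) → CMType F)
    (i : Fin (N + 1)) : AVDominatedBy (cmRealisation h₃ (cmCode F (Θ₀ i))).AV (cmProdAV F h₃ N Θ₀) := by
  classical
  refine AVDominatedBy.cmProdAV_of_biproduct ?_
  exact ⟨biproduct.ι (fun j => (cmRealisation h₃ (cmCode F (Θ₀ j))).AV) i,
    biproduct.π (fun j => (cmRealisation h₃ (cmCode F (Θ₀ j))).AV) i, 1, one_ne_zero,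
    by rw [biproduct.ι_π_self, one_smul]⟩

/-- **Every `A_{(F,Φ)}` is dominated by `∏_i A_{(F,Θ₀ i)}` as soon as `Θ₀` meets the `(Aut F × {1, bar})`-orbit of
`Φ`**: `A_Φ ≼ A_{Φ̄}` and `A_Φ ≼ A_{Φ^e}` (twisting the `𝓞_F`-action by complex conjugation / by `e⁻¹` realises the other
type on the same variety: `QuarticCM.avDominatedBy_cmAV_bar`, `…_cmTypeMap`, Shimura §6.1 Corollary), then the factor
domination. [cite: Deligne1982HodgeCycles, §5 (b)] [cite: Shimura1998, §6.1 Corollary of Theorem 2 (p. 41)] -/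
theorem avDominatedBy_cmAV_of_meets (h₃ : CMAbelianVarietyRealised) {N : ℕ} {Θ₀ : Fin (N + 1) → CMType F}
    (hΘ₀ : ∀ Φ : CMType F, ∃ (i : Fin (N + 1)) (e : F ≃+* F), Θ₀ i = cmTypeMap e Φ ∨ Θ₀ i = cmTypeMap e (bar Φ))
    (Φ : CMType F) : AVDominatedBy (cmRealisation h₃ (cmCode F Φ)).AV (cmProdAV F h₃ N Θ₀) := by
  obtain ⟨i, e, h | h⟩ := hΘ₀ Φ
  · have h1 := QuarticCM.avDominatedBy_cmAV_cmTypeMap h₃ Φ e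
    rw [← h] at h1
    exact h1.trans (avDominatedBy_cmAV_cmProdAV h₃ Θ₀ i)
  · have h0 := QuarticCM.avDominatedBy_cmAV_bar h₃ (bar Φ)
    rw [bar_bar] at h0
    have h1 := QuarticCM.avDominatedBy_cmAV_cmTypeMap h₃ (bar Φ) e
    rw [← h] at h1
    exact (h0.trans h1).trans (avDominatedBy_cmAV_cmProdAV h₃ Θ₀ i)

omit [NumberField F] [IsCMField F] in
/-- A surjective family meets every orbit (with `e = 1`). [folklore] -/
theorem meets_of_surjective {N : ℕ} {Θ₀ : Fin (N + 1) → CMType F} (hΘ₀ : Function.Surjective Θ₀) (Φ : CMType F) :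
    ∃ (i : Fin (N + 1)) (e : F ≃+* F), Θ₀ i = cmTypeMap e Φ ∨ Θ₀ i = cmTypeMap e (bar Φ) := by
  obtain ⟨i, hi⟩ := hΘ₀ Φ
  refine ⟨i, RingEquiv.refl F, Or.inl ?_⟩
  rw [hi]
  refine Subtype.ext (Set.ext fun s => ?_)
  rw [mem_cmTypeMap_iff, RingEquiv.toRingHom_refl, RingHom.comp_id]

/-- **Every `∏_{j ≤ n} A_{(F,Θ_j)}` is an isogeny factor of the power `P_F^{n+1}`** of `P_F := ∏_i A_{(F,Θ₀ i)}`, for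
`Θ₀` meeting every `(Aut F × {1, bar})`-orbit (factorwise `avDominatedBy_cmAV_of_meets`, assembled with the same nesting on
both sides by `CyclotomicSlice.avDominatedBy_cmProdAV_powSucc`). [cite: MumfordAV1970, §19] -/
theorem avDominatedBy_cmProdAV_powSucc_of_meets (h₃ : CMAbelianVarietyRealised) {N : ℕ}
    {Θ₀ : Fin (N + 1) → CMType F}
    (hΘ₀ : ∀ Φ : CMType F, ∃ (i : Fin (N + 1)) (e : F ≃+* F), Θ₀ i = cmTypeMap e Φ ∨ Θ₀ i = cmTypeMap e (bar Φ))
    (n : ℕ) (Θ : Fin (n + 1) → CMType F) :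
    AVDominatedBy (cmProdAV F h₃ n Θ) ((cmProdAV F h₃ N Θ₀).powSucc n) :=
  CyclotomicSlice.avDominatedBy_cmProdAV_powSucc F h₃ n Θ fun j => avDominatedBy_cmAV_of_meets h₃ hΘ₀ (Θ j)

/-- Conversely every power `P_F^{k+1}` is dominated by some `∏_j A_{(F,Θ_j)}` (a power is a product tree of `P_F`'s;
re-association `Domination.exists_avDominatedBy_cmProdAV_of_isProductOf`). [cite: MumfordAV1970, §19] -/
theorem exists_avDominatedBy_powSucc_cmProdAV (h₃ : CMAbelianVarietyRealised) {N : ℕ} (Θ₀ : Fin (N + 1) → CMType F)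
    (k : ℕ) : ∃ (n : ℕ) (Θ : Fin (n + 1) → CMType F), AVDominatedBy ((cmProdAV F h₃ N Θ₀).powSucc k) (cmProdAV F h₃ n Θ) :=
  exists_avDominatedBy_cmProdAV_of_isProductOf h₃
    (isProductOf_powSucc (Q := fun B => ∃ (n : ℕ) (Θ : Fin (n + 1) → CMType F), AVDominatedBy B (cmProdAV F h₃ n Θ))
      ⟨N, Θ₀, AVDominatedBy.refl _⟩ k)

/-- **The slice at `F` is decided by ONE abelian variety**: for `Θ₀` meeting every `(Aut F × {1, bar})`-orbit of CM types,
HC for all `∏_j A_{(F,Θ_j)}` ⟺ HC for all powers `P_F^{k+1}` of `P_F = ∏_i A_{(F,Θ₀ i)}`.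
[cite: MumfordAV1970, §19 Thm. 1 and p. 169] [cite: Deligne1982HodgeCycles, §5 (b)] -/
theorem forall_cmProdAV_iff_forall_powSucc (h₃ : CMAbelianVarietyRealised) {N : ℕ} {Θ₀ : Fin (N + 1) → CMType F}
    (hΘ₀ : ∀ Φ : CMType F, ∃ (i : Fin (N + 1)) (e : F ≃+* F), Θ₀ i = cmTypeMap e Φ ∨ Θ₀ i = cmTypeMap e (bar Φ)) :
    (∀ (n : ℕ) (Θ : Fin (n + 1) → CMType F), HodgeConjectureFor (cmProdAV F h₃ n Θ).dim (cmProdAV F h₃ n Θ).X) ↔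
      ∀ k : ℕ, HodgeConjectureFor ((cmProdAV F h₃ N Θ₀).powSucc k).dim ((cmProdAV F h₃ N Θ₀).powSucc k).X := by
  refine ⟨fun h k => ?_, fun h n Θ => hodgeConjectureFor_of_avDominatedBy (h n) (avDominatedBy_cmProdAV_powSucc_of_meets h₃ hΘ₀ n Θ)⟩
  obtain ⟨n, Θ, hk⟩ := exists_avDominatedBy_powSucc_cmProdAV h₃ Θ₀ k
  exact hodgeConjectureFor_of_avDominatedBy (h n Θ) hk

/-- The same for a SURJECTIVE finite family `Θ₀` (all CM types of `F`, in any order, repetitions allowed).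
[cite: MumfordAV1970, §19 Thm. 1 and p. 169] -/
theorem forall_cmProdAV_iff_forall_powSucc_of_surjective (h₃ : CMAbelianVarietyRealised) {N : ℕ}
    {Θ₀ : Fin (N + 1) → CMType F} (hΘ₀ : Function.Surjective Θ₀) :
    (∀ (n : ℕ) (Θ : Fin (n + 1) → CMType F), HodgeConjectureFor (cmProdAV F h₃ n Θ).dim (cmProdAV F h₃ n Θ).X) ↔
      ∀ k : ℕ, HodgeConjectureFor ((cmProdAV F h₃ N Θ₀).powSucc k).dim ((cmProdAV F h₃ N Θ₀).powSucc k).X :=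
  forall_cmProdAV_iff_forall_powSucc h₃ (meets_of_surjective hΘ₀)

/-- **CM types can be enumerated**: a CM field has finitely many (`2^{[F:ℚ]/2}`) and at least one CM type, so there is a
surjective `Θ₀ : Fin (N+1) → CMType F`. [cite: Shimura1998, §5.2 (pp. 36–37)] -/
theorem exists_surjective_cmType (F : Type) [Field F] [NumberField F] [IsCMField F] :
    ∃ (N : ℕ) (Θ₀ : Fin (N + 1) → CMType F), Function.Surjective Θ₀ := by
  haveI : Finite (CMType F) := by
    unfold CMType
    infer_instance
  obtain ⟨Φ₀⟩ := nonempty_cmType F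
  obtain ⟨m, ⟨ε⟩⟩ := Finite.exists_equiv_fin (CMType F)
  have hm : m ≠ 0 := by
    rintro rfl
    exact Fin.elim0 (ε Φ₀)
  obtain ⟨N, rfl⟩ := Nat.exists_eq_succ_of_ne_zero hm
  exact ⟨N, ε.symm, ε.symm.surjective⟩

/-- **`HC_CM` ⟺ one abelian variety per Galois CM field of degree `≥ 6`**: for every CM field `F` Galois over `ℚ` with
`6 ≤ [F:ℚ]` and every enumeration `Θ₀` of its CM types, the Hodge conjecture for all powers `P_F^{k+1}` of
`P_F = ∏_i A_{(F,Θ₀ i)}`.  Neither side is asserted. [cite: Milne2020HodgeClassesAV, proof of Theorem 1] [cite: MumfordAV1970, §19 Thm. 1 and p. 169] -/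
theorem hc_cm_iff_forall_galois_powSucc (h₃ : CMAbelianVarietyRealised) :
    HC_CM ↔ ∀ (F : Type) [Field F] [NumberField F] [IsCMField F], IsGalois ℚ F → 6 ≤ Module.finrank ℚ F →
      ∀ (N : ℕ) (Θ₀ : Fin (N + 1) → CMType F), Function.Surjective Θ₀ →
        ∀ k : ℕ, HodgeConjectureFor ((cmProdAV F h₃ N Θ₀).powSucc k).dim ((cmProdAV F h₃ N Θ₀).powSucc k).X := by
  rw [hc_cm_iff_forall_galois_cmProdAV h₃]
  refine ⟨fun h F _ _ _ hG h6 N Θ₀ hΘ₀ => (forall_cmProdAV_iff_forall_powSucc_of_surjective h₃ hΘ₀).1 (h F hG h6),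
    fun h F _ _ _ hG h6 => ?_⟩
  obtain ⟨N, Θ₀, hΘ₀⟩ := exists_surjective_cmType F
  exact (forall_cmProdAV_iff_forall_powSucc_of_surjective h₃ hΘ₀).2 (h F hG h6 N Θ₀ hΘ₀)

/-- **… and it suffices to test ONE enumeration per field**: `HC_CM` follows from — for every Galois CM field `F` of degree
`≥ 6` — the existence of SOME family `Θ₀` meeting every `(Aut F × {1, bar})`-orbit of CM types with HC on all powers of
`∏_i A_{(F,Θ₀ i)}`. [cite: Milne2020HodgeClassesAV, proof of Theorem 1] [cite: Deligne1982HodgeCycles, §5 (b)] -/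
theorem hc_cm_of_forall_galois_exists_powSucc (h₃ : CMAbelianVarietyRealised)
    (h : ∀ (F : Type) [Field F] [NumberField F] [IsCMField F], IsGalois ℚ F → 6 ≤ Module.finrank ℚ F →
      ∃ (N : ℕ) (Θ₀ : Fin (N + 1) → CMType F),
        (∀ Φ : CMType F, ∃ (i : Fin (N + 1)) (e : F ≃+* F), Θ₀ i = cmTypeMap e Φ ∨ Θ₀ i = cmTypeMap e (bar Φ)) ∧
        ∀ k : ℕ, HodgeConjectureFor ((cmProdAV F h₃ N Θ₀).powSucc k).dim ((cmProdAV F h₃ N Θ₀).powSucc k).X) :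
    HC_CM := by
  refine hc_cm_of_forall_galois_cmProdAV h₃ fun F _ _ _ hG h6 => ?_
  obtain ⟨N, Θ₀, hΘ₀, hP⟩ := h F hG h6
  exact (forall_cmProdAV_iff_forall_powSucc h₃ hΘ₀).2 hP

end Summit.HodgeConjecture.CorCM.SliceExhaustion

end
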